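import Summits.NavierStokesRegularity.NavierStokesRegularity.Theses.SqueezeCycle

/-!
# NavierStokesRegularity — route `SqueezeCycle`, assembly

Settles `stmt-NavierStokesRegularity-11616` (assembly of route SqueezeCycle):

  `MustSqueeze → ExtremalElementExists → ExtremalBiaxialitySubcritical → SingularZoom → NoTypeII →
   NoBlowupToClay → NavierStokesRegularity`.

The hypothesis list is, in the same order, the hypothesis list of the route's deciding theorem
`Summit.NavierStokesRegularity.NavierStokesRegularity.Theses.SqueezeCycle.closes`, so the assembly
is that theorem curried. For the record, the logic of `closes` (pure logic, no analysis):
Step 1 — for `u ∈ 𝒦_C` either the Leray-gauge middle strain eigenvalue is `≤ 1/8` at every point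
(then `MustSqueeze` gives `u ≡ 0`) or some point violates it (then `ExtremalElementExists` yields an
extremal `(u', m ≥ 1/8, (t₀, x₀))` and `ExtremalBiaxialitySubcritical` gives `m < 1/8`, absurd), so the
Liouville statement `SqueezeLiouville` holds; Step 2 — `NoBlowupToClay` reduces Clay (A) to
continuation past every `T`, `NoTypeII` gives the Type-I rate for a non-extendable solution, and
`SingularZoom` needs only "no singular element of `𝒦_C`", which the Liouville statement supplies.
Nothing here is new mathematics; the open content lives in the cruxes.
-/

namespace Summit.NavierStokesRegularity.NavierStokesRegularity.Theorems

open Summit.NavierStokesRegularity.NavierStokesRegularity.Theses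

/-- Assembly of route SqueezeCycle (`stmt-NavierStokesRegularity-11616`):
`MustSqueeze → ExtremalElementExists → ExtremalBiaxialitySubcritical → SingularZoom → NoTypeII →
NoBlowupToClay → NavierStokesRegularity`, obtained by currying the route's deciding theorem
`SqueezeCycle.closes` (dichotomy on the middle strain eigenvalue, then the shared
NoTypeII/SingularZoom/NoBlowupToClay tail). [folklore] -/
theorem squeezeCycle_assembly_proof : SqueezeCycle.Assembly := by
  unfold SqueezeCycle.Assembly
  intro hM hE hX hZ hII hClay
  exact SqueezeCycle.closes hM hE hX hZ hII hClay

end Summit.NavierStokesRegularity.NavierStokesRegularity.Theorems
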